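import Summits.QuantumAdvantage.QuantumAdvantage.Theorems.CharDialColumnDialC
import Literature.Computability.MetaComplexity.HegedusLemma
import Literature.Computability.MetaComplexity.SmolenskyMajority
import HarnessLib

/-!
# CharDial — the SYMMETRIC-BLOCK LAW (part D): ORDINARY symmetry suffices for degree-`(p−1)` strategies (Hegedűs); the ASYMMETRIC residual

Tree twin, part D, of the decomp-qadv lens-5 g34 node (rev2); imports part C.  The law (`symBlockLaw`, part B) needs a block that is
symmetric MODULO `p` (`SymBlock`: outputs see the number of ones on the block only mod `p`) and no degree hypothesis.  Here the DEGREE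
hypothesis of `CharDial.FrobHardOdd` (every cut of `𝔽_p`-degree `≤ p − 1`) is brought in, for the first time in this decomposition, through
HEGEDŰS'S LEMMA (tree `Hegedus.eval_eq_zero_of_forall_wt_eq`, Srinivasan 2023 Lemma 1.1): a weight-class function on `{0,1}^m` of degree
`≤ p − 1` takes equal values on the layers `k` and `k + p` (`layer_step`; small `k` through the complement, `layer_step'`), hence is
`p`-PERIODIC in the weight (`periodic_of_lowDeg`, `m ≥ 3p − 3`).  Consequently (§3, block coordinates `blockExt`) an ORDINARILY symmetric
block — outputs invariant under permuting its positions, `PermBlock` — of size `≥ 3p − 3` of a degree-`(p−1)` strategy IS a symmetric block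
mod `p` (★★ `symBlock_of_permBlock`), so ★★ `permBlockLaw`: degree-`(p−1)` strategies with an ordinarily symmetric block of size
`max m₀(p) 3p` win on `≤ (6/7)·2ⁿ` inputs, and item 32598 is EQUIVALENT to its ASYMMETRIC residual `AsymFrobOdd` (strategies in which every
`m`-set of positions is seen asymmetrically by some cut): `frobHardOdd_of_asym`, `frobHardOdd_iff_asym`; `AsymFrobOdd ⟺ RainbowFrobOdd`
directly (`asymFrobOdd_of_rainbow`, `rainbowFrobOdd_of_asym`).  Kernel-checked, no `sorry`, no instances, no notation.
-/

set_option autoImplicit false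
set_option linter.dupNamespace false

namespace Summit.QuantumAdvantage.QuantumAdvantage.Theorems.ColumnDial

open Finset
open Summit.QuantumAdvantage.AdviceFreeQNC0
open Literature.Computability.MetaComplexity Literature.Computability.MetaComplexity.Smolensky

/-! ### §1 Ordinary symmetric blocks -/

/-- ORDINARY symmetry of the block `S`: inputs agreeing off `S` with the SAME NUMBER OF ONES on `S` get the same output at every cut
(equivalently: every cut's output is invariant under all permutations of the positions in `S`).  No modulus. -/
def PermBlock {n : ℕ} (S : Finset (Fin n)) (y : Fin (n + 1) → (Fin n → Bool) → Bool) : Prop :=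
  ∀ g u v, (∀ i, i ∉ S → u i = v i) → SubChar.bw S u = SubChar.bw S v → y g u = y g v

/-- `y` has an ordinarily symmetric block of size `≥ m`. -/
def HasPermBlock {n : ℕ} (m : ℕ) (y : Fin (n + 1) → (Fin n → Bool) → Bool) : Prop :=
  ∃ S : Finset (Fin n), m ≤ S.card ∧ PermBlock S y

/-- a symmetric block modulo `p` is an ordinarily symmetric block. -/
theorem permBlock_of_symBlock {n p : ℕ} {S : Finset (Fin n)} {y : Fin (n + 1) → (Fin n → Bool) → Bool}
    (h : SymBlock p S y) : PermBlock S y :=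
  fun g u v huv hw => h g u v huv (by rw [hw])

/-- A symmetric block mod `p` of size `≥ m` is in particular an ordinarily symmetric block of size `≥ m`. -/
theorem hasPermBlock_of_hasSymBlock {n p m : ℕ} {y : Fin (n + 1) → (Fin n → Bool) → Bool}
    (h : HasSymBlock p m y) : HasPermBlock m y := by
  obtain ⟨S, hm, hS⟩ := h
  exact ⟨S, hm, permBlock_of_symBlock hS⟩

/-! ### §2 Hegedűs periodicity: a weight-class function of `𝔽_p`-degree `≤ p − 1` sees the weight only modulo `p` -/

section Periodicity

variable {p : ℕ} [hp : Fact p.Prime] {m : ℕ}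

/-- every weight `k ≤ m` is attained on `{0,1}^m`. -/
theorem exists_word_of_wt {k : ℕ} (hk : k ≤ m) : ∃ a : Fin m → Bool, Hegedus.wt a = k := by
  obtain ⟨t, -, ht⟩ := Finset.exists_subset_card_eq (s := (univ : Finset (Fin m))) (n := k) (by simpa using hk)
  refine ⟨fun j => decide (j ∈ t), ?_⟩
  unfold Hegedus.wt
  rw [← ht]
  congr 1
  ext j
  simp

/-- ONE HEGEDŰS STEP (`Hegedus.eval_eq_zero_of_forall_wt_eq` with `ℓ = 1`, applied to `Q − Q(a)`): a weight-class function of degree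
`≤ p − 1` takes the same value on the layers `k` and `k + p` once `p ≤ k + 1`. -/
theorem layer_step {Q : CubeFn (ZMod p) m} (hQ : Q ∈ lowDeg (ZMod p) m (p - 1))
    (hsym : ∀ a b : Fin m → Bool, Hegedus.wt a = Hegedus.wt b → Q a = Q b)
    {a b : Fin m → Bool} (hk : p - 1 ≤ Hegedus.wt a) (hb : Hegedus.wt b = Hegedus.wt a + p) : Q a = Q b := by
  have hc : (fun _ : Fin m → Bool => Q a) ∈ lowDeg (ZMod p) m (p - 1) := by
    have h : (fun _ : Fin m → Bool => Q a) = Q a • mono (ZMod p) (∅ : Finset (Fin m)) := by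
      rw [mono_empty]; funext b; simp
    rw [h]
    exact Submodule.smul_mem _ _ (mono_mem_lowDeg (by simp))
  have hP : (Q - fun _ => Q a) ∈ lowDeg (ZMod p) m (p - 1) := Submodule.sub_mem _ hQ hc
  have hvan : ∀ a' : Fin m → Bool, Hegedus.wt a' = Hegedus.wt a → ((Q - fun _ => Q a : CubeFn (ZMod p) m)) a' = 0 := by
    intro a' ha'
    rw [Pi.sub_apply, hsym a' a ha', sub_self]
  have h1 : p ^ 1 ≤ Hegedus.wt a + 1 := by rw [pow_one]; have := hp.out.one_lt; omega
  have h2 : p - 1 < p ^ 1 := by rw [pow_one]; exact Nat.sub_lt hp.out.pos one_pos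
  have hb' : Hegedus.wt b = Hegedus.wt a + p ^ 1 := by rw [pow_one, hb]
  have h := Hegedus.eval_eq_zero_of_forall_wt_eq (F := ZMod p) p (ℓ := 1) h1 h2 hP hvan hb'
  rw [Pi.sub_apply] at h
  exact (sub_eq_zero.1 h).symm

/-- the step for ALL layers once `m ≥ 3p − 3`: small layers are reached through the complement `a ↦ ¬a`
(`Smolensky.funLeft_bnot_mem_lowDeg`, `Hegedus.wt_not`). -/
theorem layer_step' (hm : 3 * p ≤ m + 3) {Q : CubeFn (ZMod p) m} (hQ : Q ∈ lowDeg (ZMod p) m (p - 1))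
    (hsym : ∀ a b : Fin m → Bool, Hegedus.wt a = Hegedus.wt b → Q a = Q b)
    {a b : Fin m → Bool} (hb : Hegedus.wt b = Hegedus.wt a + p) : Q a = Q b := by
  by_cases hk : p - 1 ≤ Hegedus.wt a
  · exact layer_step hQ hsym hk hb
  · have hQ' : LinearMap.funLeft (ZMod p) (ZMod p) bnot Q ∈ lowDeg (ZMod p) m (p - 1) := funLeft_bnot_mem_lowDeg hQ
    have hwn : ∀ x : Fin m → Bool, Hegedus.wt (bnot x) = m - Hegedus.wt x := fun x => Hegedus.wt_not x
    have hsym' : ∀ x z : Fin m → Bool, Hegedus.wt x = Hegedus.wt z →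
        LinearMap.funLeft (ZMod p) (ZMod p) bnot Q x = LinearMap.funLeft (ZMod p) (ZMod p) bnot Q z := by
      intro x z hxz
      rw [LinearMap.funLeft_apply, LinearMap.funLeft_apply]
      exact hsym _ _ (by rw [hwn, hwn, hxz])
    have hbm : Hegedus.wt b ≤ m := by
      unfold Hegedus.wt; exact (card_filter_le _ _).trans (by simp)
    have hk' : p - 1 ≤ Hegedus.wt (bnot b) := by rw [hwn]; omega
    have hb' : Hegedus.wt (bnot a) = Hegedus.wt (bnot b) + p := by rw [hwn, hwn]; omega
    have h := layer_step hQ' hsym' hk' hb'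
    rw [LinearMap.funLeft_apply, LinearMap.funLeft_apply, bnot_bnot, bnot_bnot] at h
    exact h.symm

/-- ★ HEGEDŰS PERIODICITY: a weight-class function on `{0,1}^m` (`m ≥ 3p − 3`) of `𝔽_p`-degree `≤ p − 1` depends on the weight only
modulo `p`.  [Hegedűs 2010 / Srinivasan 2023 Lemma 1.1, via the tree's `Hegedus.eval_eq_zero_of_forall_wt_eq`] -/
theorem periodic_of_lowDeg (hm : 3 * p ≤ m + 3) {Q : CubeFn (ZMod p) m} (hQ : Q ∈ lowDeg (ZMod p) m (p - 1))
    (hsym : ∀ a b : Fin m → Bool, Hegedus.wt a = Hegedus.wt b → Q a = Q b)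
    (a b : Fin m → Bool) (hab : Hegedus.wt a % p = Hegedus.wt b % p) : Q a = Q b := by
  suffices key : ∀ t : ℕ, ∀ a b : Fin m → Bool, Hegedus.wt b = Hegedus.wt a + p * t → Q a = Q b by
    rcases le_total (Hegedus.wt a) (Hegedus.wt b) with hle | hle
    · obtain ⟨t, ht⟩ : p ∣ Hegedus.wt b - Hegedus.wt a := (Nat.modEq_iff_dvd' hle).1 hab
      exact key t a b (by omega)
    · obtain ⟨t, ht⟩ : p ∣ Hegedus.wt a - Hegedus.wt b := (Nat.modEq_iff_dvd' hle).1 hab.symm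
      exact (key t b a (by omega)).symm
  intro t
  induction t with
  | zero => intro a b h; exact hsym a b (by omega)
  | succ t ih =>
    intro a b h
    have hbm : Hegedus.wt b ≤ m := by
      unfold Hegedus.wt; exact (card_filter_le _ _).trans (by simp)
    obtain ⟨c, hc⟩ := exists_word_of_wt (m := m) (k := Hegedus.wt a + p * t) (by nlinarith)
    exact (ih a c hc).trans (layer_step' hm hQ hsym (by rw [hc, h]; ring))

end Periodicity

/-! ### §3 Block coordinates, and ★★ the bridge `PermBlock + degree ≤ p − 1 ⇒ SymBlock` -/

section Bridge

variable {n p : ℕ} [hp : Fact p.Prime]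

/-- re-insert a block word `a` (indexed by `Fin S.card` through `S.equivFin`) into the base input `u`. -/
noncomputable def blockExt (S : Finset (Fin n)) (u : Fin n → Bool) (a : Fin S.card → Bool) : Fin n → Bool :=
  fun i => if h : i ∈ S then a (S.equivFin ⟨i, h⟩) else u i

/-- Off `S` the block extension `blockExt S u a` reads `u`. -/
theorem blockExt_of_not_mem (S : Finset (Fin n)) (u : Fin n → Bool) (a : Fin S.card → Bool) {i : Fin n} (hi : i ∉ S) :
    blockExt S u a i = u i := by
  simp [blockExt, hi]

/-- On `S` the block extension `blockExt S u a` reads the block word `a` through `S.equivFin`. -/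
theorem blockExt_of_mem (S : Finset (Fin n)) (u : Fin n → Bool) (a : Fin S.card → Bool) {i : Fin n} (hi : i ∈ S) :
    blockExt S u a i = a (S.equivFin ⟨i, hi⟩) := by
  simp [blockExt, hi]

/-- the block weight of a re-inserted word is its Hamming weight. -/
theorem bw_blockExt (S : Finset (Fin n)) (u : Fin n → Bool) (a : Fin S.card → Bool) :
    SubChar.bw S (blockExt S u a) = Hegedus.wt a := by
  classical
  unfold SubChar.bw Hegedus.wt
  rw [Finset.card_filter, Finset.card_filter, ← Finset.sum_coe_sort S]
  refine Fintype.sum_equiv S.equivFin _ _ fun i => ?_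
  rw [blockExt_of_mem S u a i.2]

/-- an input agreeing with `u` off `S` is a re-inserted word. -/
theorem blockExt_restrict (S : Finset (Fin n)) {u v : Fin n → Bool} (huv : ∀ i, i ∉ S → u i = v i) :
    blockExt S u (fun j => v ((S.equivFin.symm j : S) : Fin n)) = v := by
  funext i
  by_cases hi : i ∈ S
  · rw [blockExt_of_mem S u _ hi, Equiv.symm_apply_apply]
  · rw [blockExt_of_not_mem S u _ hi, huv i hi]

/-- the pulled-back indicator of a cut has degree `≤ D` in the block variables (`Smolensky.comp_mem_lowDeg_of_coord`: each coordinate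
of `blockExt S u` is a variable or a constant). -/
theorem indicator_blockExt_mem_lowDeg (S : Finset (Fin n)) (u : Fin n → Bool) {f : (Fin n → Bool) → Bool} {D : ℕ}
    (hf : HasDegF p f D) :
    (fun a : Fin S.card → Bool => if f (blockExt S u a) then (1 : ZMod p) else 0) ∈ lowDeg (ZMod p) S.card D := by
  classical
  refine Smolensky.comp_mem_lowDeg_of_coord (F := ZMod p) (blockExt S u) (fun i => ?_) hf
  by_cases hi : i ∈ S
  · have h : (fun a : Fin S.card → Bool => if blockExt S u a i = true then (1 : ZMod p) else 0) =
        mono (ZMod p) ({S.equivFin ⟨i, hi⟩} : Finset (Fin S.card)) := by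
      funext a
      rw [blockExt_of_mem S u a hi, mono_apply]
      simp
    rw [h]
    exact mono_mem_lowDeg (by simp)
  · have h : (fun a : Fin S.card → Bool => if blockExt S u a i = true then (1 : ZMod p) else 0) =
        (if u i = true then (1 : ZMod p) else 0) • mono (ZMod p) (∅ : Finset (Fin S.card)) := by
      funext a; rw [blockExt_of_not_mem S u a hi, mono_empty]; simp
    rw [h]
    exact Submodule.smul_mem _ _ (mono_mem_lowDeg (by simp))

/-- ★★ THE BRIDGE: an ORDINARILY symmetric block of size `≥ 3p − 3` of a strategy all of whose cuts have `𝔽_p`-degree `≤ p − 1` is a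
symmetric block MODULO `p`.  (Per cut `g` and base input `u`: the indicator `a ↦ [y_g(blockExt S u a)]` is a weight-class function of degree
`≤ p − 1` on `{0,1}^{|S|}`, hence `p`-periodic in the weight by `periodic_of_lowDeg`.)  This is where the DEGREE hypothesis of
`CharDial.FrobHardOdd` enters the lens-5 decomposition for the first time. -/
theorem symBlock_of_permBlock {S : Finset (Fin n)} {y : Fin (n + 1) → (Fin n → Bool) → Bool}
    (hdeg : ∀ g, HasDegF p (y g) (p - 1)) (hS : PermBlock S y) (hm : 3 * p ≤ S.card + 3) : SymBlock p S y := by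
  classical
  intro g u v huv hmod
  have hQ := indicator_blockExt_mem_lowDeg S u (hdeg g)
  have hsym : ∀ a b : Fin S.card → Bool, Hegedus.wt a = Hegedus.wt b →
      (fun a : Fin S.card → Bool => if y g (blockExt S u a) then (1 : ZMod p) else 0) a =
        (fun a : Fin S.card → Bool => if y g (blockExt S u a) then (1 : ZMod p) else 0) b := by
    intro a b hab
    have h : y g (blockExt S u a) = y g (blockExt S u b) :=
      hS g _ _ (fun i hi => by rw [blockExt_of_not_mem S u a hi, blockExt_of_not_mem S u b hi])
        (by rw [bw_blockExt, bw_blockExt, hab])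
    simp only [h]
  have hmod' : SubChar.bw S u % p = SubChar.bw S v % p := (ZMod.natCast_eq_natCast_iff' _ _ _).1 hmod
  have hu : blockExt S u (fun j => u ((S.equivFin.symm j : S) : Fin n)) = u := blockExt_restrict S fun _ _ => rfl
  have hv : blockExt S u (fun j => v ((S.equivFin.symm j : S) : Fin n)) = v := blockExt_restrict S huv
  have hwa : Hegedus.wt (fun j => u ((S.equivFin.symm j : S) : Fin n)) % p
      = Hegedus.wt (fun j => v ((S.equivFin.symm j : S) : Fin n)) % p := by
    rw [← bw_blockExt S u, ← bw_blockExt S u, hu, hv, hmod']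
  have key := periodic_of_lowDeg hm hQ hsym _ _ hwa
  simp only [hu, hv] at key
  by_contra hne
  have h10 : (1 : ZMod p) ≠ 0 := one_ne_zero
  revert key
  cases hyu : y g u <;> cases hyv : y g v <;> simp_all

/-- hence, for degree-`(p − 1)` strategies, an ordinarily symmetric block of size `max m (3p)` yields a symmetric block mod `p` of size `m`. -/
theorem hasSymBlock_of_hasPermBlock {m : ℕ} {y : Fin (n + 1) → (Fin n → Bool) → Bool}
    (hdeg : ∀ g, HasDegF p (y g) (p - 1)) (h : HasPermBlock (max m (3 * p)) y) : HasSymBlock p m y := by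
  obtain ⟨S, hS, hP⟩ := h
  exact ⟨S, (le_max_left _ _).trans hS, symBlock_of_permBlock hdeg hP (by have := (le_max_right m (3 * p)).trans hS; omega)⟩

end Bridge

/-! ### §4 Consequences for item 32598: symmetric strategies lose; the residual is the ASYMMETRIC core -/

/-- ★★ **DEGREE-`(p−1)` STRATEGIES WITH AN ORDINARILY SYMMETRIC BLOCK LOSE**: for every prime `p ≥ 5` there is `m₁(p)` (`= max m₀(p) 3p`)
such that every strategy all of whose cuts have `𝔽_p`-degree `≤ p − 1` and which has a block of `≥ m₁` input positions seen SYMMETRICALLY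
by every cut (outputs invariant under permuting those positions) wins the walk game on at most `(6/7)·2ⁿ` inputs — every `n`, every charge.
[the law `symBlockLaw` + the bridge `symBlock_of_permBlock`] -/
theorem permBlockLaw (p : ℕ) [Fact p.Prime] (h5 : 5 ≤ p) : ∃ m₁ : ℕ, ∀ (n c : ℕ)
    (y : Fin (n + 1) → (Fin n → Bool) → Bool), (∀ g, HasDegF p (y g) (p - 1)) → HasPermBlock m₁ y →
      ((univ.filter fun u : Fin n → Bool => ringWinU c y u = true).card : ℝ) ≤ 6 / 7 * (2 : ℝ) ^ n := by
  obtain ⟨m₀, h⟩ := symBlockLaw p (by omega) (coprime_three_of_prime h5)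
  exact ⟨max m₀ (3 * p), fun n c y hdeg hP => h n c y (hasSymBlock_of_hasPermBlock hdeg hP)⟩

/-- piece (B′), the ASYMMETRIC RESIDUAL: `FrobHardOdd` restricted, for every `m`, to strategies with NO ordinarily symmetric block of
size `m` — every `m`-set of input positions is seen asymmetrically by some cut on some outside.  [T-implied: `asymFrobOdd_of_frobHardOdd`;
UNDECIDED; `⟺ FrobHardOdd`: `frobHardOdd_iff_asym`] -/
def AsymFrobOdd : Prop :=
  ∀ (p : ℕ) [Fact p.Prime], 5 ≤ p → ∀ m : ℕ, ∃ θ : ℝ, θ < 1 ∧ ∃ n₀ : ℕ, ∀ n ≥ n₀, ∀ c : ℕ,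
    ∀ y : Fin (n + 1) → (Fin n → Bool) → Bool, (∀ g, HasDegF p (y g) (p - 1)) → ¬ HasPermBlock m y →
      ((univ.filter fun u : Fin n → Bool => ringWinU c y u = true).card : ℝ) ≤ θ * (2 : ℝ) ^ n

/-- ★★ item 32598 from its ASYMMETRIC residual alone. -/
theorem frobHardOdd_of_asym (hB : AsymFrobOdd) :
    Summit.QuantumAdvantage.QuantumAdvantage.Theses.CharDial.FrobHardOdd := by
  intro p _ hp
  obtain ⟨m₁, h₁⟩ := permBlockLaw p hp
  obtain ⟨θ₂, hθ₂, n₂, h₂⟩ := hB p hp m₁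
  refine ⟨max (6 / 7) θ₂, max_lt (by norm_num) hθ₂, n₂, fun n hn c y hy => ?_⟩
  have h2 : (0 : ℝ) ≤ (2 : ℝ) ^ n := by positivity
  by_cases hS : HasPermBlock m₁ y
  · exact (h₁ n c y hy hS).trans (mul_le_mul_of_nonneg_right (le_max_left _ _) h2)
  · exact (h₂ n hn c y hy hS).trans (mul_le_mul_of_nonneg_right (le_max_right _ _) h2)

/-- converse: `T` implies the asymmetric residual (drop the hypothesis). -/
theorem asymFrobOdd_of_frobHardOdd (hT : Summit.QuantumAdvantage.QuantumAdvantage.Theses.CharDial.FrobHardOdd) : AsymFrobOdd := by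
  intro p _ hp m
  obtain ⟨θ, hθ, n₀, h⟩ := hT p hp
  exact ⟨θ, hθ, n₀, fun n hn c y hy _ => h n hn c y hy⟩

/-- ★★ `CharDial.FrobHardOdd` (32598) is EQUIVALENT to its asymmetric residual. -/
theorem frobHardOdd_iff_asym :
    Summit.QuantumAdvantage.QuantumAdvantage.Theses.CharDial.FrobHardOdd ↔ AsymFrobOdd :=
  ⟨asymFrobOdd_of_frobHardOdd, frobHardOdd_of_asym⟩

/-- the asymmetric residual refines the rainbow residual directly (its hypothesis class is smaller: no symmetric block mod `p` of size `m`
is implied by no ordinarily symmetric block of size `m`). -/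
theorem asymFrobOdd_of_rainbow (hB : RainbowFrobOdd) : AsymFrobOdd := by
  intro p _ hp m
  obtain ⟨θ, hθ, n₀, h⟩ := hB p hp m
  exact ⟨θ, hθ, n₀, fun n hn c y hy hS => h n hn c y hy fun hS' => hS (hasPermBlock_of_hasSymBlock hS')⟩

/-- and conversely through the bridge (block size `max m 3p`). -/
theorem rainbowFrobOdd_of_asym (hB : AsymFrobOdd) : RainbowFrobOdd := by
  intro p _ hp m
  obtain ⟨θ, hθ, n₀, h⟩ := hB p hp (max m (3 * p))
  exact ⟨θ, hθ, n₀, fun n hn c y hy hS => h n hn c y hy fun hP => hS (hasSymBlock_of_hasPermBlock hy hP)⟩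

end Summit.QuantumAdvantage.QuantumAdvantage.Theorems.ColumnDial
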